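import Literature.Geometry.Lorentzian.InverseMeanCurvatureFlowExteriorExistence
import HarnessLib

/-!
# Inverse mean curvature flow I — proofs: pointwise bounds by chaining from `∂E₀`
# (verification of the Arzelà–Ascoli hypotheses in the proof of Thm. 3.1)

In Huisken–Ilmanen's proof of the Weak Existence Theorem 3.1 (J. Differential Geom. 59 (2001),
§3, p. 26), the Arzelà–Ascoli theorem is applied to the regularised solutions `u^{ε,L}` using
only "(3.8) and (3.9) … yield uniform `C^{0,1}` estimates (independent of `ε` and `L`) on each
compact set": pointwise bounds are tacit, and follow because all `u^{ε,L}` vanish on `∂E₀` and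
`M` is connected — one chains the local Lipschitz bounds along a path from `∂E₀`. This file proves
that step (`exists_forall_abs_le_of_lipschitz_chain`) and thereby removes the pointwise upper bound
hypothesis from `weak_existence_of_regularised_dirichlet_solutions`
(`InverseMeanCurvatureFlowExteriorExistence.lean`), leaving as hypotheses only the direct
analytic output of Lemmas 3.4–3.5 plus the per-`L` sup bound of the maximum principle
(`weak_existence_of_regularised_dirichlet_solutions'`):

* `exists_nhds_forall_edist_le` — the Riemannian distance is bounded on a neighbourhood of
  each point (charts are locally bi-Lipschitz for the length distance,
  `exists_nhds_riemannianEDist_le_and_edist_le`);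
* `forall_mem_Icc_of_chain` — **continuous induction along a curve**: a property of points of
  `S` which is locally invariant (every point of `S` has a neighbourhood within which it passes
  between any two points of `S`) propagates along a curve in `S`
  (`IsClosed.Icc_subset_of_forall_mem_nhdsWithin`);
* `exists_forall_abs_le_of_lipschitz_chain` — **eventual pointwise bounds**: if the `w_{L,k}`
  vanish on `∂E₀`, are equi-Lipschitz near `∂E₀` on `X ∖ E₀`, and have local gradient bounds near
  every point of `X ∖ Ē₀` for `L` large, then at every `x ∉ E₀`, `|w_{L,k} x| ≤ B` for `L ≥ L₀`
  (a path from `x` to a point of `E₀ ≠ ∅` — `X` is a connected manifold, hence path connected —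
  first meets `Ē₀` at a point of `∂E₀`; chain back from there).

Everything is proved; there are no definitions and no named facts.

## References

* G. Huisken, T. Ilmanen, *The inverse mean curvature flow and the Riemannian Penrose
  inequality*, J. Differential Geom. 59 (2001) 353–437: §3, proof of Thm. 3.1, step 1 ("By the
  Arzela–Ascoli theorem …"), Lemma 3.4 (remark after (3.10)).
-/

noncomputable section

open Bundle Set Manifold TopologicalSpace Filter MeasureTheory Function
open scoped ContDiff Topology ENNReal NNReal Manifold Real

namespace Literature.Geometry.Lorentzian

open PseudoRiemannianMetric

variable {X : Type*} [TopologicalSpace X] [ChartedSpace E3 X] [IsManifold (𝓡 3) ∞ X]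
  (h : ContMDiffRiemannianMetric (𝓡 3) ∞ E3 (TangentSpace (𝓡 3) : X → Type _))
  [T2Space X] [LocallyCompactSpace X]

/-! ### Local boundedness of the Riemannian distance -/

set_option backward.isDefEq.respectTransparency false in
/-- Every point has a neighbourhood of bounded diameter for the Riemannian distance (in a chart
that is `2`-bi-Lipschitz for the length distance and bounded). [folklore] -/
theorem exists_nhds_forall_edist_le (y : X) :
    letI : RiemannianBundle (fun x : X ↦ TangentSpace (𝓡 3) x) :=
      ⟨h.toContinuousRiemannianMetric.toRiemannianMetric⟩
    letI : PseudoEMetricSpace X := .ofRiemannianMetric (𝓡 3) X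
    ∃ V ∈ 𝓝 y, ∃ D : ℝ≥0, ∀ p ∈ V, ∀ q ∈ V, edist p q ≤ D := by
  letI : RiemannianBundle (fun x : X ↦ TangentSpace (𝓡 3) x) :=
    ⟨h.toContinuousRiemannianMetric.toRiemannianMetric⟩
  letI : PseudoEMetricSpace X := .ofRiemannianMetric (𝓡 3) X
  set φ := extChartAt (𝓡 3) y with hφ
  obtain ⟨A, hA⟩ := exists_norm_eq_norm_symmL (I := 𝓡 3) y y
  obtain ⟨U₂, hU₂, -, hle, -⟩ :=
    exists_nhds_riemannianEDist_le_and_edist_le (I := 𝓡 3) y y (mem_chart_source E3 y) hA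
      one_lt_two
  -- a sub-neighbourhood on which the chart stays in the unit ball around `φ y`
  have hball : φ ⁻¹' Metric.ball (φ y) 1 ∈ 𝓝 y :=
    (continuousAt_extChartAt y).preimage_mem_nhds (Metric.ball_mem_nhds _ one_pos)
  refine ⟨U₂ ∩ φ ⁻¹' Metric.ball (φ y) 1, inter_mem hU₂ hball, 2 * (‖A‖₊ * 2), ?_⟩
  intro p hp q hq
  have hpq := hle p hp.1 q hq.1
  have hd : dist (φ p) (φ q) ≤ 2 := by
    have h1 : dist (φ p) (φ y) < 1 := hp.2
    have h2 : dist (φ q) (φ y) < 1 := hq.2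
    calc dist (φ p) (φ q) ≤ dist (φ p) (φ y) + dist (φ q) (φ y) := dist_triangle_right _ _ _
      _ ≤ 2 := by linarith
  have hA2 : edist (A (φ p)) (A (φ q)) ≤ (‖A‖₊ * 2 : ℝ≥0) := by
    rw [edist_dist, ← ENNReal.ofReal_coe_nnreal]
    refine ENNReal.ofReal_le_ofReal ?_
    rw [dist_eq_norm, ← map_sub]
    calc ‖A (φ p - φ q)‖ ≤ ‖A‖ * ‖φ p - φ q‖ := A.le_opNorm _
      _ ≤ ‖A‖ * 2 := by rw [← dist_eq_norm]; gcongr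
      _ = (‖A‖₊ * 2 : ℝ≥0) := by push_cast; ring
  calc edist p q = riemannianEDist (𝓡 3) p q := rfl
    _ ≤ (2 : ℝ≥0) * edist (A (φ p)) (A (φ q)) := hpq
    _ ≤ (2 : ℝ≥0) * ((‖A‖₊ * 2 : ℝ≥0) : ℝ≥0∞) := by gcongr
    _ = ((2 * (‖A‖₊ * 2) : ℝ≥0) : ℝ≥0∞) := by push_cast; ring

/-! ### Continuous induction along a curve -/

omit [ChartedSpace E3 X] [IsManifold (𝓡 3) ∞ X] [T2Space X] [LocallyCompactSpace X] in
/-- **Continuous induction along a curve.** Let `P` be a property of points which is *locally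
invariant on `S`*: every point of `S` has a neighbourhood `N` such that `P` passes from any point
of `N ∩ S` to any other. If `γ : ℝ → X` is continuous with `γ([a, b]) ⊆ S` and `P (γ a)`, then
`P (γ t)` for all `t ∈ [a, b]` (the set of good parameters is closed and right-open in `[a, b]`,
`IsClosed.Icc_subset_of_forall_mem_nhdsWithin`). [folklore] -/
theorem forall_mem_Icc_of_chain {S : Set X} {P : X → Prop}
    (hloc : ∀ y ∈ S, ∃ N ∈ 𝓝 y, ∀ p ∈ N ∩ S, ∀ q ∈ N ∩ S, P p → P q)
    {γ : ℝ → X} (hγ : Continuous γ) {a b : ℝ} (hγS : ∀ t ∈ Icc a b, γ t ∈ S) (ha : P (γ a)) :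
    ∀ t ∈ Icc a b, P (γ t) := by
  set s : Set ℝ := {t | t ∈ Icc a b → P (γ t)} with hs
  have hsI : s ∩ Icc a b = {t | t ∈ Icc a b ∧ P (γ t)} := by
    ext t; simp only [hs, mem_inter_iff, mem_setOf_eq]; tauto
  -- the good set is closed in `[a, b]`
  have hclosed : IsClosed (s ∩ Icc a b) := by
    rw [hsI, ← closure_subset_iff_isClosed]
    intro t ht
    have htI : t ∈ Icc a b :=
      closure_minimal (fun u hu ↦ hu.1) isClosed_Icc ht
    refine ⟨htI, ?_⟩
    obtain ⟨N, hN, hP⟩ := hloc (γ t) (hγS t htI)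
    have hpre : γ ⁻¹' N ∈ 𝓝 t := hγ.continuousAt.preimage_mem_nhds hN
    obtain ⟨u, hu, huN⟩ : ∃ u, u ∈ {t | t ∈ Icc a b ∧ P (γ t)} ∧ u ∈ γ ⁻¹' N := by
      have := mem_closure_iff_nhds.1 ht (γ ⁻¹' N) hpre
      obtain ⟨u, hu1, hu2⟩ := this
      exact ⟨u, hu2, hu1⟩
    exact hP (γ u) ⟨huN, hγS u hu.1⟩ (γ t) ⟨mem_of_mem_nhds hN, hγS t htI⟩ hu.2
  have has : a ∈ s := fun _ ↦ ha
  have hgt : ∀ x ∈ s ∩ Ico a b, s ∈ 𝓝[>] x := by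
    rintro x ⟨hxs, hxI⟩
    have hxI' : x ∈ Icc a b := ⟨hxI.1, hxI.2.le⟩
    obtain ⟨N, hN, hP⟩ := hloc (γ x) (hγS x hxI')
    have hpre : γ ⁻¹' N ∈ 𝓝 x := hγ.continuousAt.preimage_mem_nhds hN
    refine mem_nhdsWithin_of_mem_nhds (mem_of_superset hpre fun t ht htI ↦ ?_)
    exact hP (γ x) ⟨mem_of_mem_nhds hN, hγS x hxI'⟩ (γ t) ⟨ht, hγS t htI⟩ (hxs hxI')
  intro t ht
  exact (hclosed.Icc_subset_of_forall_mem_nhdsWithin has hgt) ht ht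

/-! ### Eventual pointwise bounds for the regularised solutions -/

variable [ConnectedSpace X]

set_option backward.isDefEq.respectTransparency false in
/-- **Pointwise bounds by chaining from `∂E₀`.** Let `E₀ ≠ ∅` be open in the connected
`3`-manifold `X` and `w_{L,k} : X → ℝ` (`C¹`) functions vanishing on `∂E₀`, equi-Lipschitz near
each point of `∂E₀` on relative neighbourhoods in `X ∖ E₀`, and with local gradient bounds near
every point of `X ∖ Ē₀` valid for `L ≥ L₀` (depending on the point). Then for every `x ∉ E₀`
there are `B` and `L₀` with `|w_{L,k} x| ≤ B` for all `L ≥ L₀` and all `k`. (A path from `x` to a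
point of `E₀` first meets `Ē₀` on `∂E₀`, where `w = 0`; the bound propagates back along the path
through finitely many neighbourhoods of bounded diameter on which the `w_{L,k}` are eventually
equi-Lipschitz.) This is the tacit verification of the hypotheses of the Arzelà–Ascoli theorem in
the proof of Thm. 3.1. [cite: HuiskenIlmanenIMCF2001, §3 proof of Thm. 3.1 (step 1)] -/
theorem exists_forall_abs_le_of_lipschitz_chain {E₀ : Set X} (hE₀ : IsOpen E₀)
    (hne : E₀.Nonempty) {w : ℕ → ℕ → X → ℝ} (hw : ∀ L k, ContMDiff (𝓡 3) 𝓘(ℝ, ℝ) 1 (w L k))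
    (hgrad : ∀ x, x ∉ closure E₀ → ∃ C : ℝ≥0, ∃ V ∈ 𝓝 x, ∃ L₀ : ℕ, ∀ L, L₀ ≤ L → ∀ k, ∀ q ∈ V,
      gradNorm h (w L k) q ≤ C)
    (hblip : letI : RiemannianBundle (fun x : X ↦ TangentSpace (𝓡 3) x) :=
        ⟨h.toContinuousRiemannianMetric.toRiemannianMetric⟩
      letI : PseudoEMetricSpace X := .ofRiemannianMetric (𝓡 3) X
      ∀ x ∈ frontier E₀, ∃ K : ℝ≥0, ∃ V ∈ 𝓝 x, ∀ L k, LipschitzOnWith K (w L k) (V ∩ E₀ᶜ))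
    (hzero : ∀ L k, ∀ x ∈ frontier E₀, w L k x = 0) :
    ∀ x, x ∉ E₀ → ∃ B : ℝ, ∃ L₀ : ℕ, ∀ L, L₀ ≤ L → ∀ k, |w L k x| ≤ B := by
  letI : RiemannianBundle (fun x : X ↦ TangentSpace (𝓡 3) x) :=
    ⟨h.toContinuousRiemannianMetric.toRiemannianMetric⟩
  letI : PseudoEMetricSpace X := .ofRiemannianMetric (𝓡 3) X
  haveI := ChartedSpace.locallyPathConnectedSpace E3 X
  haveI : PathConnectedSpace X := PathConnectedSpace.of_locallyPathConnectedSpace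
  have hfront : frontier E₀ = closure E₀ \ E₀ := by rw [frontier, hE₀.interior_eq]
  -- the property and its local invariance on `S = E₀ᶜ`
  set P : X → Prop := fun y ↦ ∃ B : ℝ, ∃ L₀ : ℕ, ∀ L, L₀ ≤ L → ∀ k, |w L k y| ≤ B with hP
  have hPf : ∀ y ∈ frontier E₀, P y := fun y hy ↦
    ⟨0, 0, fun L _ k ↦ by rw [hzero L k y hy, abs_zero]⟩
  -- eventual equi-Lipschitz bounds near every point of `E₀ᶜ`
  have hlip : ∀ y, y ∉ E₀ → ∃ K : ℝ≥0, ∃ V ∈ 𝓝 y, ∃ L₁ : ℕ, ∀ L, L₁ ≤ L → ∀ k,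
      LipschitzOnWith K (w L k) (V ∩ E₀ᶜ) := by
    intro y hyE
    by_cases hyc : y ∈ closure E₀
    · obtain ⟨K, V, hV, hK⟩ := hblip y (hfront ▸ ⟨hyc, hyE⟩)
      exact ⟨K, V, hV, 0, fun L _ k ↦ hK L k⟩
    · obtain ⟨C, V, hV, L₀, hC⟩ := hgrad y hyc
      obtain ⟨W, hW, hWV, c, hc⟩ :=
        exists_nhds_subset_forall_lipschitzOnWith_of_gradNorm_le h y hV
      refine ⟨C * c, W, hW, L₀, fun L hL k ↦ (hc (w L k) C
        (fun q _ ↦ (hw L k).mdifferentiableAt one_ne_zero)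
        fun q hq ↦ hC L hL k q (hWV hq)).mono inter_subset_left⟩
  have hloc : ∀ y ∈ E₀ᶜ, ∃ N ∈ 𝓝 y, ∀ p ∈ N ∩ E₀ᶜ, ∀ q ∈ N ∩ E₀ᶜ, P p → P q := by
    intro y hyE
    obtain ⟨K, V, hV, L₁, hK⟩ := hlip y hyE
    obtain ⟨V', hV', D, hD⟩ := exists_nhds_forall_edist_le h y
    refine ⟨V ∩ V', inter_mem hV hV', fun p hp q hq ⟨B, L₀, hB⟩ ↦ ⟨B + K * D, max L₀ L₁, ?_⟩⟩
    intro L hL k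
    have h1 : |w L k q - w L k p| ≤ K * D :=
      abs_sub_le_of_lipschitzOnWith (hK L (le_of_max_le_right hL) k) ⟨hq.1.1, hq.2⟩
        ⟨hp.1.1, hp.2⟩ D.coe_nonneg (by
          rw [ENNReal.ofReal_coe_nnreal]; exact hD q hq.1.2 p hp.1.2)
    have h2 := hB L (le_of_max_le_left hL) k
    calc |w L k q| = |(w L k q - w L k p) + w L k p| := by ring_nf
      _ ≤ |w L k q - w L k p| + |w L k p| := abs_add_le _ _
      _ ≤ B + K * D := by linarith
  -- the path from `x` to a point of `E₀` and its first contact with `Ē₀`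
  intro x hxE
  by_cases hxc : x ∈ closure E₀
  · exact hPf x (hfront ▸ ⟨hxc, hxE⟩)
  obtain ⟨e, he⟩ := hne
  set γ : Path x e := PathConnectedSpace.somePath x e with hγ
  set g : ℝ → X := fun t ↦ γ.extend t with hg
  have hgc : Continuous g := γ.continuous_extend
  have hg0 : g 0 = x := γ.extend_zero
  have hg1 : g 1 = e := γ.extend_one
  set T : Set ℝ := {t | t ∈ Icc (0 : ℝ) 1 ∧ g t ∈ closure E₀} with hT
  have hTc : IsClosed T := isClosed_Icc.inter (isClosed_closure.preimage hgc)
  have hTne : T.Nonempty := ⟨1, ⟨zero_le_one, le_rfl⟩, by rw [hg1]; exact subset_closure he⟩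
  have hTbdd : BddBelow T := ⟨0, fun t ht ↦ ht.1.1⟩
  set τ : ℝ := sInf T with hτ
  have hτT : τ ∈ T := hTc.csInf_mem hTne hTbdd
  have hτ0 : 0 ≤ τ := hτT.1.1
  have hτ1 : τ ≤ 1 := hτT.1.2
  have hbelow : ∀ t, 0 ≤ t → t < τ → g t ∉ closure E₀ := fun t ht0 htτ hgt ↦
    absurd (csInf_le hTbdd ⟨⟨ht0, htτ.le.trans hτ1⟩, hgt⟩) (not_le.2 htτ)
  have hτpos : 0 < τ := by
    rcases eq_or_lt_of_le hτ0 with h0 | hlt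
    · exfalso; apply hxc; rw [← hg0, h0]; exact hτT.2
    · exact hlt
  have hτf : g τ ∈ frontier E₀ := by
    rw [hfront]
    refine ⟨hτT.2, fun hgE ↦ ?_⟩
    -- `g ⁻¹' E₀` is a neighbourhood of `τ`, containing points `t < τ`
    have hpre : g ⁻¹' E₀ ∈ 𝓝 τ := hgc.continuousAt.preimage_mem_nhds (hE₀.mem_nhds hgE)
    obtain ⟨δ, hδ, hδsub⟩ := Metric.mem_nhds_iff.1 hpre
    set t : ℝ := max 0 (τ - δ / 2) with ht
    have ht0 : 0 ≤ t := le_max_left _ _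
    have htτ : t < τ := max_lt hτpos (by linarith)
    have htball : t ∈ Metric.ball τ δ := by
      rw [Metric.mem_ball, Real.dist_eq, abs_sub_lt_iff]
      constructor <;> [linarith; linarith [le_max_right 0 (τ - δ / 2)]]
    exact hbelow t ht0 htτ (subset_closure (hδsub htball))
  -- chain back along the reversed path `s ↦ g (τ - s)`, `s ∈ [0, τ]`
  have hchain := forall_mem_Icc_of_chain (S := E₀ᶜ) (P := P) hloc
    (γ := fun s ↦ g (τ - s)) (hgc.comp (continuous_const.sub continuous_id)) (a := 0) (b := τ)
    (fun s hs ↦ by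
      rcases eq_or_lt_of_le hs.1 with h0 | hpos
      · simp only [← h0, sub_zero]
        exact (hfront ▸ hτf).2
      · exact fun hgE ↦ hbelow (τ - s) (by linarith [hs.2]) (by linarith) (subset_closure hgE))
    (by simpa only [sub_zero] using hPf (g τ) hτf)
  have := hchain τ ⟨hτ0, le_rfl⟩
  simpa only [sub_self, hg0] using this

/-! ### The named fact from the PDE package, without pointwise upper bounds -/

variable [SecondCountableTopology X] [MeasurableSpace X] [BorelSpace X] [NoncompactSpace X]
  [(ofRiemannian h).HasLeviCivita]

/-- **`weak_existence` from the elliptic regularisation (sharper hypotheses).** As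
`weak_existence_of_regularised_dirichlet_solutions`, with the pointwise upper bounds uniform in
`(L, k)` replaced by the per-`L` sup bound `w_{L,k} ≤ B_L` on `U_L ∖ E₀` (the maximum principle
for (⋆)_ε: `u^ε ≤ L − 2`); the uniform pointwise bounds needed for the Arzelà–Ascoli extraction in
`L` are derived by chaining from `∂E₀` (`exists_forall_abs_le_of_lipschitz_chain`), as tacitly in
the printed proof. [cite: HuiskenIlmanenIMCF2001, Thm. 3.1, Lemmas 3.4–3.5] -/
theorem weak_existence_of_regularised_dirichlet_solutions'
    (H : ∀ (X : Type) [TopologicalSpace X] [ChartedSpace E3 X] [IsManifold (𝓡 3) ∞ X]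
      [T2Space X] [SecondCountableTopology X] [LocallyCompactSpace X] [ConnectedSpace X]
      [NoncompactSpace X] [MeasurableSpace X] [BorelSpace X]
      (h : ContMDiffRiemannianMetric (𝓡 3) ∞ E3 (TangentSpace (𝓡 3) : X → Type _))
      [(ofRiemannian h).HasLeviCivita],
      IsGeodesicallyComplete (ofRiemannian h).leviCivita →
      ∀ (E₀ F₀ : Set X) (v : X → ℝ), E₀.Nonempty → IsSmoothPrecompactOpen E₀ →
        IsWeakSubsolutionIVP h v F₀ → IsProperFun v → IsCompact (closure F₀) → closure E₀ ⊆ F₀ →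
        ∃ (U : ℕ → Set X) (w : ℕ → ℕ → X → ℝ) (ε : ℕ → ℕ → ℝ) (ψ : ℕ → ℕ → X → ℝ)
          (η : ℕ → ℕ → ℝ) (b : ℕ → ℝ),
          (∀ L, IsOpen (U L)) ∧ (∀ L, closure E₀ ⊆ U L) ∧ (∀ L M : ℕ, L ≤ M → U L ⊆ U M) ∧
          (∀ K : Set X, IsCompact K → ∃ L, K ⊆ U L) ∧ Tendsto b atTop atTop ∧
          (∀ L k, ContMDiff (𝓡 3) 𝓘(ℝ, ℝ) 2 (w L k)) ∧ (∀ L k, 0 < ε L k) ∧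
          (∀ L, Tendsto (ε L) atTop (𝓝 0)) ∧
          (∀ L k x, ψ L k x = Real.sqrt (gradNorm h (w L k) x ^ 2 + ε L k ^ 2)) ∧
          (∀ L k, ContMDiffOn (𝓡 3) 𝓘(ℝ, ℝ) 1 (ψ L k) (U L \ closure E₀)) ∧
          (∀ L k, ∀ x ∈ U L \ closure E₀, ψ L k x * (ofRiemannian h).dalembertian (w L k) x -
            (ofRiemannian h).innerDual x (mvfderiv (𝓡 3) (ψ L k) x).toLinearMap
              (mvfderiv (𝓡 3) (w L k) x).toLinearMap = ψ L k x ^ 3) ∧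
          (∀ L, ∀ x ∈ U L \ closure E₀, ∃ C : ℝ≥0, ∃ V ∈ 𝓝 x, ∀ k, ∀ q ∈ V,
            gradNorm h (w L k) q ≤ C) ∧
          (∀ x, x ∉ closure E₀ → ∃ C : ℝ≥0, ∃ V ∈ 𝓝 x, ∃ L₀ : ℕ, ∀ L, L₀ ≤ L → ∀ k, ∀ q ∈ V,
            gradNorm h (w L k) q ≤ C) ∧
          (letI : RiemannianBundle (fun x : X ↦ TangentSpace (𝓡 3) x) :=
              ⟨h.toContinuousRiemannianMetric.toRiemannianMetric⟩;
            letI : PseudoEMetricSpace X := .ofRiemannianMetric (𝓡 3) X;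
            ∀ x ∈ frontier E₀, ∃ K : ℝ≥0, ∃ V ∈ 𝓝 x, ∀ L k,
              LipschitzOnWith K (w L k) (V ∩ E₀ᶜ)) ∧
          (∀ L k, ∀ x ∈ frontier E₀, w L k x = 0) ∧
          (∀ L, Tendsto (η L) atTop (𝓝 0)) ∧ (∀ L k, ∀ x ∈ U L, x ∉ E₀ → -η L k ≤ w L k x) ∧
          (∀ L, ∃ B : ℝ, ∀ k, ∀ x ∈ U L, x ∉ E₀ → w L k x ≤ B) ∧
          (∀ L, ∀ δ : ℝ, 0 < δ → ∃ C : Set X, IsCompact C ∧ C ⊆ U L ∧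
            ∀ k, ∀ x ∈ U L, x ∉ C → b L - δ ≤ w L k x)) :
    weak_existence := by
  refine weak_existence_of_regularised_dirichlet_solutions
    fun X _ _ _ _ _ _ _ _ _ _ h _ hcomplete E₀ F₀ v hne hE₀ hv hvp hF₀ hE₀F₀ ↦ ?_
  obtain ⟨U, w, ε, ψ, η, b, hUo, hE₀U, hUmono, hexh, hb, hw, hε, hε0, hψ, hψ1, hpde, hgradL, hgrad,
    hblip, hzero, hη, hlow, hupL, hbar⟩ := H X h hcomplete E₀ F₀ v hne hE₀ hv hvp hF₀ hE₀F₀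
  refine ⟨U, w, ε, ψ, η, b, hUo, hE₀U, hUmono, hexh, hb, hw, hε, hε0, hψ, hψ1, hpde, hgradL, hgrad,
    hblip, hzero, hη, hlow, fun x hxE ↦ ?_, hbar⟩
  -- pointwise upper bounds uniform in `(L, k)`: chaining for `L ≥ L₀`, the sup bounds below `L₀`
  obtain ⟨B, L₀, hB⟩ := exists_forall_abs_le_of_lipschitz_chain h hE₀.1 hne
    (fun L k ↦ (hw L k).of_le (by norm_num)) hgrad hblip hzero x hxE
  choose Bf hBf using hupL
  refine ⟨max B (∑ L ∈ Finset.range L₀, |Bf L|), fun L k hxU ↦ ?_⟩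
  by_cases hL : L₀ ≤ L
  · exact ((le_abs_self _).trans (hB L hL k)).trans (le_max_left _ _)
  · have hLr : L ∈ Finset.range L₀ := Finset.mem_range.2 (not_le.1 hL)
    calc w L k x ≤ Bf L := hBf L k x hxU hxE
      _ ≤ |Bf L| := le_abs_self _
      _ ≤ ∑ L ∈ Finset.range L₀, |Bf L| :=
          Finset.single_le_sum (fun i _ ↦ abs_nonneg (Bf i)) hLr
      _ ≤ max B (∑ L ∈ Finset.range L₀, |Bf L|) := le_max_right _ _

end Literature.Geometry.Lorentzian

end
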